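import Mathlib
import Summits.Langlands.Langlands.Theses.DyadicOddResidue
import Literature.NumberTheory.Automorphic.FontaineMazurHilbertTotallySplit
import Literature.NumberTheory.Automorphic.POrdinaryHeckeAlgebraGL2
import Summits.Langlands.Langlands.Theorems.PhantomRMYoshidaResiduallyYoshidaLiftingTraceLimit
import Summits.Langlands.Langlands.Theorems.IrreducibilityBySelfDualityIrreducibleOffSectorIotaTransport

/-!
# Stub C `automorphyPropagates` of crux `DyadicEisensteinFM` (stmt-Langlands-18741): the degenerate
# case "the two points of the family coincide on traces" (lines `ordinary-seed-propagation`,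
# `close-approximation-cc`; `--supports` file, closes nothing)

Helper file for the crux `Summit.Langlands.Langlands.Theses.DyadicOddResidue.DyadicEisensteinFM`
(Fontaine–Mazur at `ℓ = 2` for residually reducible odd regular `ρ : Γ_ℚ → GL₂(ℚ̄₂)`).  The registered
stub `stub_automorphyPropagates` (C) of the checked skeletons `Cruxes/DyadicEisensteinFM/Lines/
ordinary_seed_propagation.lean` and `…/close_approximation_cc.lean` asks: if `ρ|_{Γ_F}` (point `x₂`) and a
CLASSICAL point `ρ₁` (point `x₁`, attached a.e. to a regular `L`-algebraic cuspidal `π₁` on `GL₂(𝔸_F)`) lie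
on one odd Eisenstein `2`-adic `F`-family `(A, D)` (`A` a compact Noetherian local domain, `D` a Chenevier
determinant of `Γ_F`), then `ρ|_{Γ_F}` is attached a.e. to a regular `L`-algebraic cuspidal `π`.  Its
intended proof (Pan's patching at the one-dimensional prime `ker x₁`, Paškūnas–Tung blocks at `p = 2`,
classicality) is OPEN.

This file proves the DEGENERATE CASE in which the two points agree on traces,
`tr ρ|_{Γ_F}(σ) = tr ρ₁(σ)` for all `σ` (e.g. `x₁ = x₂` on the trace algebra): then `π := π₁` works.
The content is the characteristic-`0` rigidity "equal traces ⟹ equal characteristic polynomials"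
plus the restriction of almost-everywhere unramifiedness from `ℚ` to `F`:

* `satakeFrobCompatibleAE_of_forall_trace_eq` — in EVERY rank `n`: `SatakeFrobCompatibleAE ι π` passes
  from `ρ` to any a.e.-unramified `ρ' : Γ_K → GL_n(ℚ̄_ℓ)` with the same trace function, because equal
  traces on a group give equal characteristic polynomials in characteristic `0` (Newton's identities on
  `tr ρ(g^j)`; the landed `charpoly_eq_of_trace_eq` of
  `Theorems/PhantomRMYoshidaResiduallyYoshidaLiftingTraceLimit`), so the predicted Frobenius polynomials
  agree;
* `eventually_isUnramifiedAt_restrictField` — `ρ` a.e. unramified over `K` ⟹ `ρ|_{Γ_L}` a.e. unramified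
  over `L` (`FramedGaloisRep.isUnramifiedAt_restrictField` + finite fibres of `w ↦ w ∩ 𝓞 K`,
  `tendsto_under_cofinite`);
* `automorphyPropagates_of_trace_eq` — stub C verbatim with the extra hypothesis
  `∀ σ, ((ρ.restrictField F) σ).val.trace = (ρ₁ σ).val.trace` inserted before `∀ hF ι`;
* `automorphyPropagates_of_points_eq` — stub C verbatim with the extra hypothesis
  `∀ σ, x₁ (D.trace σ) = x₂ (D.trace σ)` (the two points coincide on traces of `D`);
* `satakeFrobCompatibleAE_of_forall_trace_eq_ringEquiv`, `automorphyPropagates_of_trace_eq_ringEquiv` — the same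
  along a coefficient automorphism `e : ℚ̄₂ ≃+* ℚ̄₂` (`tr ρ|_{Γ_F} = e ∘ tr ρ₁`: e.g. the constant family `A = 𝒪_E`
  read through two different embeddings `x₁ ≠ x₂`), by re-indexing `ι ↦ ι ∘ e` in the `∀ ι` seed hypothesis
  (landed `IrreducibleOffSector.map_arithFrobPolyOfSatake_trans`, `charpoly_eq_map_of_forall_trace_eq`).

No definitions, no named facts, no `sorry`; standard axioms.  What remains OPEN of stub C is the case where
`x₂ ∘ tr D` is not a coefficient-conjugate of `x₁ ∘ tr D`: spreading automorphy from one point of the domain `A` to a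
genuinely different one.
-/

set_option linter.dupNamespace false -- project-wide option (lakefile weak.linter.dupNamespace); `Summit.Langlands.Langlands` is the mandated namespace
set_option linter.overlappingInstances false -- the REGISTERED stub signature binds `[IsDomain A] … [IsLocalRing A]` verbatim (as in the checked skeleton); kept byte-identical here

noncomputable section

namespace Summit.Langlands.Langlands.Theorems.DyadicEisensteinFM

open Literature.NumberTheory.Automorphic Literature.NumberTheory.GaloisRepresentations
open Literature.NumberTheory.PAdicHodge
open scoped MatrixGroups
open NumberField IsDedekindDomain Filter Field Polynomial

/-! ## 1. Transport of `SatakeFrobCompatibleAE` along equal traces; restriction of a.e. unramifiedness -/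

section Transport

open scoped Classical

variable {K : Type} [Field K] [NumberField K] {ℓ : ℕ} [Fact ℓ.Prime]

/-- **Almost-everywhere unramifiedness restricts.**  If `ρ : Γ_K → GL_n(A)` is unramified at all but
finitely many places of `K`, then `ρ|_{Γ_L}` is unramified at all but finitely many places of the finite
extension `L` (inertia at `𝔔 ∣ w` maps into inertia at the prime below, `FramedGaloisRep.isUnramifiedAt_restrictField`;
the map `w ↦ w ∩ 𝓞 K` has finite fibres, `tendsto_under_cofinite`). -/
theorem eventually_isUnramifiedAt_restrictField (L : Type) [Field L] [NumberField L] [Algebra K L]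
    {A : Type*} [CommRing A] [TopologicalSpace A] {n : ℕ} (ρ : FramedGaloisRep K A n)
    (h : ∀ᶠ v : HeightOneSpectrum (𝓞 K) in cofinite, ρ.IsUnramifiedAt v) :
    ∀ᶠ w : HeightOneSpectrum (𝓞 L) in cofinite, (ρ.restrictField L).IsUnramifiedAt w := by
  filter_upwards [(tendsto_under_cofinite (𝓞 K) (B := 𝓞 L)).eventually h] with w hw
  exact ρ.isUnramifiedAt_restrictField (v := w.under (𝓞 K)) rfl hw

/-- **`SatakeFrobCompatibleAE` only sees traces (characteristic `0`, every rank).**  If `ρ` is attached to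
`π` at almost all places and `ρ' : Γ_K → GL_n(ℚ̄_ℓ)` has the same trace function and is unramified almost
everywhere, then `ρ'` is attached to `π` at almost all places: at a place good for both, the predicted
polynomial `∏ (X − ι⁻¹(α_j⁻¹))` is the characteristic polynomial of `ρ(Frob)`, which equals that of
`ρ'(Frob)` — equal traces on the group `Γ_K` give equal traces of all powers, hence equal characteristic
polynomials by Newton's identities in characteristic `0` (`charpoly_eq_of_trace_eq`).  (`Classical`: the
place subtypes indexing `mixedSpace K` are `Fintype` classically, needed to write `AutomorphyDatum.gl n K hcpt`,
as in `IsAutomorphicAE`.) -/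
theorem satakeFrobCompatibleAE_of_forall_trace_eq {n : ℕ} {hcpt : isCompact_glFiniteIntegralLevel n K}
    {ι : PadicAlgCl ℓ ≃+* ℂ} {π : AutomorphicRepData (AutomorphyDatum.gl n K hcpt)}
    {ρ ρ' : FramedGaloisRep K (PadicAlgCl ℓ) n}
    (htr : ∀ σ, ((ρ' σ : GL (Fin n) (PadicAlgCl ℓ)) : Matrix (Fin n) (Fin n) (PadicAlgCl ℓ)).trace =
      ((ρ σ : GL (Fin n) (PadicAlgCl ℓ)) : Matrix (Fin n) (Fin n) (PadicAlgCl ℓ)).trace)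
    (hunr : ∀ᶠ v : HeightOneSpectrum (𝓞 K) in cofinite, ρ'.IsUnramifiedAt v)
    (h : SatakeFrobCompatibleAE ι π ρ) : SatakeFrobCompatibleAE ι π ρ' := by
  filter_upwards [h, hunr] with v ⟨α, hα, _, hP⟩ hv
  refine ⟨α, hα, hv, fun 𝔓 h𝔓 σ hσ => ?_⟩
  rw [← hP 𝔓 h𝔓 σ hσ]
  exact Cruxes.ResiduallyYoshidaLifting.EndoscopicCrossingEuler.charpoly_eq_of_trace_eq
    (ρ : absoluteGaloisGroup K →* GL (Fin n) (PadicAlgCl ℓ))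
    (ρ' : absoluteGaloisGroup K →* GL (Fin n) (PadicAlgCl ℓ)) htr σ

/-- **Traces conjugate under a ring map give characteristic polynomials conjugate under it** (characteristic
`0`, every rank): if `tr r'(g) = f(tr r(g))` for all `g` then `det(X − r'(g)) = f(det(X − r(g)))`, by Newton's
identities (`charpoly_eq_of_trace_pow_eq`) applied to `r'(g)` and the entrywise image `f(r(g))`
(`Matrix.charpoly_map`, `AddMonoidHom.map_trace`). -/
theorem charpoly_eq_map_of_forall_trace_eq {G : Type*} [Monoid G] {A B : Type*} [CommRing A] [CommRing B]
    [IsDomain B] [CharZero B] {n : ℕ} (f : A →+* B) (r : G →* GL (Fin n) A) (r' : G →* GL (Fin n) B)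
    (h : ∀ g, ((r' g : GL (Fin n) B) : Matrix (Fin n) (Fin n) B).trace =
      f ((r g : GL (Fin n) A) : Matrix (Fin n) (Fin n) A).trace) (g : G) :
    ((r' g : GL (Fin n) B) : Matrix (Fin n) (Fin n) B).charpoly =
      (((r g : GL (Fin n) A) : Matrix (Fin n) (Fin n) A).charpoly).map f := by
  rw [← Matrix.charpoly_map]
  refine Cruxes.ResiduallyYoshidaLifting.EndoscopicCrossingEuler.charpoly_eq_of_trace_pow_eq fun j => ?_
  rw [← Matrix.map_pow, ← Units.val_pow_eq_pow_val, ← Units.val_pow_eq_pow_val, ← map_pow, ← map_pow, h]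
  exact AddMonoidHom.map_trace f.toAddMonoidHom _

/-- **`SatakeFrobCompatibleAE` along a coefficient automorphism** (characteristic `0`, every rank): if `ρ` is
attached to `π` via `ι ∘ e` and `ρ' : Γ_K → GL_n(ℚ̄_ℓ)` is a.e. unramified with `tr ρ' = e ∘ tr ρ` (e.g. `ρ' = ᵉρ`,
the coefficient-conjugate), then `ρ'` is attached to `π` via `ι`: `charpoly ρ'(Frob) = e(charpoly ρ(Frob)) =
e(∏ (X − (ι∘e)⁻¹(α_j⁻¹))) = ∏ (X − ι⁻¹(α_j⁻¹))` (`charpoly_eq_map_of_forall_trace_eq`, and the landed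
`IrreducibleOffSector.map_arithFrobPolyOfSatake_trans`).  The case `e = 1` is
`satakeFrobCompatibleAE_of_forall_trace_eq`. -/
theorem satakeFrobCompatibleAE_of_forall_trace_eq_ringEquiv {n : ℕ} {hcpt : isCompact_glFiniteIntegralLevel n K}
    {ι : PadicAlgCl ℓ ≃+* ℂ} {π : AutomorphicRepData (AutomorphyDatum.gl n K hcpt)}
    {ρ ρ' : FramedGaloisRep K (PadicAlgCl ℓ) n} (e : PadicAlgCl ℓ ≃+* PadicAlgCl ℓ)
    (htr : ∀ σ, ((ρ' σ : GL (Fin n) (PadicAlgCl ℓ)) : Matrix (Fin n) (Fin n) (PadicAlgCl ℓ)).trace =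
      e ((ρ σ : GL (Fin n) (PadicAlgCl ℓ)) : Matrix (Fin n) (Fin n) (PadicAlgCl ℓ)).trace)
    (hunr : ∀ᶠ v : HeightOneSpectrum (𝓞 K) in cofinite, ρ'.IsUnramifiedAt v)
    (h : SatakeFrobCompatibleAE (e.trans ι) π ρ) : SatakeFrobCompatibleAE ι π ρ' := by
  filter_upwards [h, hunr] with v ⟨α, hα, _, hP⟩ hv
  refine ⟨α, hα, hv, fun 𝔓 h𝔓 σ hσ => ?_⟩
  rw [← IrreducibleOffSector.map_arithFrobPolyOfSatake_trans e ι, ← hP 𝔓 h𝔓 σ hσ]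
  exact charpoly_eq_map_of_forall_trace_eq (e : PadicAlgCl ℓ →+* PadicAlgCl ℓ)
    (ρ : absoluteGaloisGroup K →* GL (Fin n) (PadicAlgCl ℓ))
    (ρ' : absoluteGaloisGroup K →* GL (Fin n) (PadicAlgCl ℓ)) htr σ

end Transport

/-! ## 2. Stub C in the degenerate case -/

/-- **Stub C (`automorphyPropagates`) when the two points coincide on traces.**  Verbatim the registered
statement `stub_automorphyPropagates` of `Cruxes/DyadicEisensteinFM/Lines/ordinary_seed_propagation.lean`
(= `…/close_approximation_cc.lean`), with ONE extra hypothesis inserted before `∀ hF ι`: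
`∀ σ, ((ρ.restrictField F) σ).val.trace = (ρ₁ σ).val.trace`.  Proof: take `π := π₁`; `ρ|_{Γ_F}` is a.e.
unramified (`eventually_isUnramifiedAt_restrictField` from the crux hypothesis over `ℚ`) and has the
Frobenius characteristic polynomials of `ρ₁` (`satakeFrobCompatibleAE_of_forall_trace_eq`).  All the family
data `(A, D, x₁, x₂)` and the remaining crux hypotheses are unused here: this is the case `x₁ ∘ tr D = x₂ ∘ tr D`
of the stub; the complementary case is its open content. -/
theorem automorphyPropagates_of_trace_eq : ∀ (ρ : Literature.NumberTheory.GaloisRepresentations.FramedGaloisRep ℚ (PadicAlgCl 2) 2), ρ.toGaloisRep.IsIrreducible → ρ.IsOdd → (∀ᶠ v : IsDedekindDomain.HeightOneSpectrum (NumberField.RingOfIntegers ℚ) in Filter.cofinite, ρ.IsUnramifiedAt v) → (∀ (v : IsDedekindDomain.HeightOneSpectrum (NumberField.RingOfIntegers ℚ)) (hv : ((2 : ℕ) : NumberField.RingOfIntegers ℚ) ∈ v.asIdeal), (Literature.NumberTheory.PAdicHodge.fontainePstAdicCompletion v 2 hv).IsDeRhamFramed (ρ.toLocal v) ∧ ∀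 τ : v.adicCompletion ℚ →+* PadicAlgCl 2, Continuous τ → (ρ.labelledHodgeTateWeightsAt v (Literature.NumberTheory.PAdicHodge.fontainePstAdicCompletion v 2 hv).algebra (Literature.NumberTheory.PAdicHodge.fontainePstAdicCompletion v 2 hv).𝔅 τ).Nodup) → ∀ (F : Type) [Field F] [NumberField F], NumberField.IsTotallyReal F → ¬ ((2 : ℤ) ∣ NumberField.discr F) → (∀ w : IsDedekindDomain.HeightOneSpectrum (NumberField.RingOfIntegers F), ((2 : ℕ) : NumberField.RingOfIntegers F) ∈ w.asIdeal → w.residueCard = 2) → (ρ.restrictField F).toGaloisRep.IsIrreducible → ∀ (A : Type) [CommRing A] [IsDomain A] [IsNoetherianRing A] [IsLocalRing A] [TopologicalSpace A] [IsTopologicalRing A] [CompactSpace A] [T2Space A] (D : Literature.NumberTheory.Automorphic.PseudoRep2 (Field.absoluteGaloisGroup F) A) (x₁ x₂ : A →+* PadicAlgCl 2) (ρ₁ : Literature.NumberTheory.GaloisRepresentations.FramedGaloisRep F (PadicAlgCl 2) 2), (Continuous D.trace ∧ (∃ S : Set (IsDedekindDomain.HeightOneSpectrum (NumberField.RingOfIntegers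 F)), S.Finite ∧ ∀ v ∉ S, ∀ 𝔓 ∈ v.primesAbove, ∀ σ ∈ 𝔓.inertia (Field.absoluteGaloisGroup F), D.det σ = 1 ∧ ∀ τ : Field.absoluteGaloisGroup F, D.trace (τ * σ) = D.trace τ) ∧ (∀ (φ : F →+* ℝ) (c : Field.absoluteGaloisGroup F), Literature.NumberTheory.GaloisRepresentations.IsComplexConjugation φ c → ((D.det c : Aˣ) : A) = -1) ∧ (∃ (k : Type) (_ : Field k) (i : IsLocalRing.ResidueField A →+* k) (χ₁ χ₂ : Field.absoluteGaloisGroup F →* kˣ), (D.map (IsLocalRing.residue A)).map i = Literature.NumberTheory.Automorphic.PseudoRep2.ofCharacters χ₁ χ₂)) → (Continuous x₁ ∧ Continuous x₂ ∧ (∀ σ, x₁ (D.trace σ) = (ρ₁ σ).val.trace) ∧ (∀ σ, x₂ (D.trace σ) = ((ρ.restrictField F) σ).val.trace)) → ((∀ (K : Type) [Field K] [NumberField K] [Algebra F K], Module.finrank F K = 2 → (ρ₁.restrictField K).toGaloisRep.IsIrreducible) ∧ (∀ (hF : Literature.NumberTheory.Automorphic.isCompact_glFiniteIntegralLevel 2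 F) (ι : PadicAlgCl 2 ≃+* ℂ), ∃ π₁ : Literature.NumberTheory.Automorphic.CuspidalAutomorphicRepData 2 F hF, π₁.1.IsLAlgebraic ∧ (∃ T : Literature.NumberTheory.Automorphic.InfinityType F 2, π₁.1.HasInfinityType T ∧ T.IsRegular) ∧ Literature.NumberTheory.Automorphic.SatakeFrobCompatibleAE ι π₁.1 ρ₁)) → (∀ σ, ((ρ.restrictField F) σ).val.trace = (ρ₁ σ).val.trace) → ∀ (hF : Literature.NumberTheory.Automorphic.isCompact_glFiniteIntegralLevel 2 F) (ι : PadicAlgCl 2 ≃+* ℂ), ∃ π : Literature.NumberTheory.Automorphic.CuspidalAutomorphicRepData 2 F hF, π.1.IsLAlgebraic ∧ (∃ T : Literature.NumberTheory.Automorphic.InfinityType F 2, π.1.HasInfinityType T ∧ T.IsRegular) ∧ Literature.NumberTheory.Automorphic.SatakeFrobCompatibleAE ι π.1 (ρ.restrictField F) := by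
  intro ρ _ _ hunr _ F _ _ _ _ _ _ A _ _ _ _ _ _ _ _ D x₁ x₂ ρ₁ _ _ hseed htr hF ι
  obtain ⟨π₁, hLalg, hT, hcompat⟩ := hseed.2 hF ι
  exact ⟨π₁, hLalg, hT, satakeFrobCompatibleAE_of_forall_trace_eq htr
    (eventually_isUnramifiedAt_restrictField F ρ hunr) hcompat⟩

/-- **Stub C (`automorphyPropagates`) when the two points `x₁, x₂` agree on the traces of `D`.**  Verbatim
the registered statement `stub_automorphyPropagates`, with ONE extra hypothesis inserted before `∀ hF ι`:
`∀ σ, x₁ (D.trace σ) = x₂ (D.trace σ)` (in particular when `x₁ = x₂`).  By the point conditions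
`x₁ (tr D σ) = tr ρ₁ σ`, `x₂ (tr D σ) = tr ρ|_{Γ_F} σ` this is `automorphyPropagates_of_trace_eq`. -/
theorem automorphyPropagates_of_points_eq : ∀ (ρ : Literature.NumberTheory.GaloisRepresentations.FramedGaloisRep ℚ (PadicAlgCl 2) 2), ρ.toGaloisRep.IsIrreducible → ρ.IsOdd → (∀ᶠ v : IsDedekindDomain.HeightOneSpectrum (NumberField.RingOfIntegers ℚ) in Filter.cofinite, ρ.IsUnramifiedAt v) → (∀ (v : IsDedekindDomain.HeightOneSpectrum (NumberField.RingOfIntegers ℚ)) (hv : ((2 : ℕ) : NumberField.RingOfIntegers ℚ) ∈ v.asIdeal), (Literature.NumberTheory.PAdicHodge.fontainePstAdicCompletion v 2 hv).IsDeRhamFramed (ρ.toLocal v) ∧ ∀ τ : v.adicCompletion ℚ →+* PadicAlgCl 2, Continuous τ → (ρ.labelledHodgeTateWeightsAt v (Literature.NumberTheory.PAdicHodge.fontainePstAdicCompletion v 2 hv).algebra (Literature.NumberTheory.PAdicHodge.fontainePstAdicCompletion v 2 hv).𝔅 τ).Nodup) → ∀ (F : Type) [Field F] [NumberField F], NumberField.IsTotallyReal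 F → ¬ ((2 : ℤ) ∣ NumberField.discr F) → (∀ w : IsDedekindDomain.HeightOneSpectrum (NumberField.RingOfIntegers F), ((2 : ℕ) : NumberField.RingOfIntegers F) ∈ w.asIdeal → w.residueCard = 2) → (ρ.restrictField F).toGaloisRep.IsIrreducible → ∀ (A : Type) [CommRing A] [IsDomain A] [IsNoetherianRing A] [IsLocalRing A] [TopologicalSpace A] [IsTopologicalRing A] [CompactSpace A] [T2Space A] (D : Literature.NumberTheory.Automorphic.PseudoRep2 (Field.absoluteGaloisGroup F) A) (x₁ x₂ : A →+* PadicAlgCl 2) (ρ₁ : Literature.NumberTheory.GaloisRepresentations.FramedGaloisRep F (PadicAlgCl 2) 2), (Continuous D.trace ∧ (∃ S : Set (IsDedekindDomain.HeightOneSpectrum (NumberField.RingOfIntegers F)), S.Finite ∧ ∀ v ∉ S, ∀ 𝔓 ∈ v.primesAbove, ∀ σ ∈ 𝔓.inertia (Field.absoluteGaloisGroup F), D.det σ = 1 ∧ ∀ τ : Field.absoluteGaloisGroup F, D.trace (τ * σ) = D.trace τ) ∧ (∀ (φ : F →+* ℝ) (c : Field.absoluteGaloisGroup F), Literature.NumberTheory.GaloisRepresentations.IsComplexConjugation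 φ c → ((D.det c : Aˣ) : A) = -1) ∧ (∃ (k : Type) (_ : Field k) (i : IsLocalRing.ResidueField A →+* k) (χ₁ χ₂ : Field.absoluteGaloisGroup F →* kˣ), (D.map (IsLocalRing.residue A)).map i = Literature.NumberTheory.Automorphic.PseudoRep2.ofCharacters χ₁ χ₂)) → (Continuous x₁ ∧ Continuous x₂ ∧ (∀ σ, x₁ (D.trace σ) = (ρ₁ σ).val.trace) ∧ (∀ σ, x₂ (D.trace σ) = ((ρ.restrictField F) σ).val.trace)) → ((∀ (K : Type) [Field K] [NumberField K] [Algebra F K], Module.finrank F K = 2 → (ρ₁.restrictField K).toGaloisRep.IsIrreducible) ∧ (∀ (hF : Literature.NumberTheory.Automorphic.isCompact_glFiniteIntegralLevel 2 F) (ι : PadicAlgCl 2 ≃+* ℂ), ∃ π₁ : Literature.NumberTheory.Automorphic.CuspidalAutomorphicRepData 2 F hF, π₁.1.IsLAlgebraic ∧ (∃ T : Literature.NumberTheory.Automorphic.InfinityType F 2, π₁.1.HasInfinityType T ∧ T.IsRegular) ∧ Literature.NumberTheory.Automorphic.SatakeFrobCompatibleAE ι π₁.1 ρ₁)) → (∀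 σ, x₁ (D.trace σ) = x₂ (D.trace σ)) → ∀ (hF : Literature.NumberTheory.Automorphic.isCompact_glFiniteIntegralLevel 2 F) (ι : PadicAlgCl 2 ≃+* ℂ), ∃ π : Literature.NumberTheory.Automorphic.CuspidalAutomorphicRepData 2 F hF, π.1.IsLAlgebraic ∧ (∃ T : Literature.NumberTheory.Automorphic.InfinityType F 2, π.1.HasInfinityType T ∧ T.IsRegular) ∧ Literature.NumberTheory.Automorphic.SatakeFrobCompatibleAE ι π.1 (ρ.restrictField F) := by
  intro ρ hirr hodd hunr hdR F _ _ hreal hdisc hsplit hirrF A _ _ _ _ _ _ _ _ D x₁ x₂ ρ₁ hfam hpts hseed hx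
  refine automorphyPropagates_of_trace_eq ρ hirr hodd hunr hdR F hreal hdisc hsplit hirrF A D x₁ x₂ ρ₁
    hfam hpts hseed fun σ => ?_
  rw [← hpts.2.2.1 σ, ← hpts.2.2.2 σ, hx σ]

/-- **Stub C (`automorphyPropagates`) when `ρ|_{Γ_F}` is a COEFFICIENT-CONJUGATE of the classical point on traces.**
Verbatim the registered statement `stub_automorphyPropagates`, with ONE extra hypothesis inserted before `∀ hF ι`:
`∃ e : ℚ̄₂ ≃+* ℚ̄₂, ∀ σ, tr ρ|_{Γ_F}(σ) = e(tr ρ₁(σ))`.  This covers `x₁ = x₂` (`e = 1`) AND the constant family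
`A = 𝒪_E`, `D = tr ρ|_{Γ_F}` read through two DIFFERENT embeddings `x₁ ≠ x₂ : 𝒪_E → ℚ̄₂` (their difference extends to
an automorphism of `ℚ̄₂`).  Proof: given `ι`, the seed is attached to `π₁` via `ι ∘ e` (hypothesis at `e.trans ι`), so
`ρ|_{Γ_F}` is attached to `π₁` via `ι` (`satakeFrobCompatibleAE_of_forall_trace_eq_ringEquiv`). -/
theorem automorphyPropagates_of_trace_eq_ringEquiv : ∀ (ρ : Literature.NumberTheory.GaloisRepresentations.FramedGaloisRep ℚ (PadicAlgCl 2) 2), ρ.toGaloisRep.IsIrreducible → ρ.IsOdd → (∀ᶠ v : IsDedekindDomain.HeightOneSpectrum (NumberField.RingOfIntegers ℚ) in Filter.cofinite, ρ.IsUnramifiedAt v) → (∀ (v : IsDedekindDomain.HeightOneSpectrum (NumberField.RingOfIntegers ℚ)) (hv : ((2 : ℕ) : NumberField.RingOfIntegers ℚ) ∈ v.asIdeal), (Literature.NumberTheory.PAdicHodge.fontainePstAdicCompletion v 2 hv).IsDeRhamFramed (ρ.toLocal v) ∧ ∀ τ : v.adicCompletion ℚ →+* PadicAlgCl 2, Continuous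 τ → (ρ.labelledHodgeTateWeightsAt v (Literature.NumberTheory.PAdicHodge.fontainePstAdicCompletion v 2 hv).algebra (Literature.NumberTheory.PAdicHodge.fontainePstAdicCompletion v 2 hv).𝔅 τ).Nodup) → ∀ (F : Type) [Field F] [NumberField F], NumberField.IsTotallyReal F → ¬ ((2 : ℤ) ∣ NumberField.discr F) → (∀ w : IsDedekindDomain.HeightOneSpectrum (NumberField.RingOfIntegers F), ((2 : ℕ) : NumberField.RingOfIntegers F) ∈ w.asIdeal → w.residueCard = 2) → (ρ.restrictField F).toGaloisRep.IsIrreducible → ∀ (A : Type) [CommRing A] [IsDomain A] [IsNoetherianRing A] [IsLocalRing A] [TopologicalSpace A] [IsTopologicalRing A] [CompactSpace A] [T2Space A] (D : Literature.NumberTheory.Automorphic.PseudoRep2 (Field.absoluteGaloisGroup F) A) (x₁ x₂ : A →+* PadicAlgCl 2) (ρ₁ : Literature.NumberTheory.GaloisRepresentations.FramedGaloisRep F (PadicAlgCl 2) 2), (Continuous D.trace ∧ (∃ S : Set (IsDedekindDomain.HeightOneSpectrum (NumberField.RingOfIntegers F)), S.Finite ∧ ∀ v ∉ S, ∀ 𝔓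 ∈ v.primesAbove, ∀ σ ∈ 𝔓.inertia (Field.absoluteGaloisGroup F), D.det σ = 1 ∧ ∀ τ : Field.absoluteGaloisGroup F, D.trace (τ * σ) = D.trace τ) ∧ (∀ (φ : F →+* ℝ) (c : Field.absoluteGaloisGroup F), Literature.NumberTheory.GaloisRepresentations.IsComplexConjugation φ c → ((D.det c : Aˣ) : A) = -1) ∧ (∃ (k : Type) (_ : Field k) (i : IsLocalRing.ResidueField A →+* k) (χ₁ χ₂ : Field.absoluteGaloisGroup F →* kˣ), (D.map (IsLocalRing.residue A)).map i = Literature.NumberTheory.Automorphic.PseudoRep2.ofCharacters χ₁ χ₂)) → (Continuous x₁ ∧ Continuous x₂ ∧ (∀ σ, x₁ (D.trace σ) = (ρ₁ σ).val.trace) ∧ (∀ σ, x₂ (D.trace σ) = ((ρ.restrictField F) σ).val.trace)) → ((∀ (K : Type) [Field K] [NumberField K] [Algebra F K], Module.finrank F K = 2 → (ρ₁.restrictField K).toGaloisRep.IsIrreducible) ∧ (∀ (hF : Literature.NumberTheory.Automorphic.isCompact_glFiniteIntegralLevel 2 F) (ι : PadicAlgCl 2 ≃+* ℂ), ∃ π₁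 : Literature.NumberTheory.Automorphic.CuspidalAutomorphicRepData 2 F hF, π₁.1.IsLAlgebraic ∧ (∃ T : Literature.NumberTheory.Automorphic.InfinityType F 2, π₁.1.HasInfinityType T ∧ T.IsRegular) ∧ Literature.NumberTheory.Automorphic.SatakeFrobCompatibleAE ι π₁.1 ρ₁)) → (∃ e : PadicAlgCl 2 ≃+* PadicAlgCl 2, ∀ σ, ((ρ.restrictField F) σ).val.trace = e ((ρ₁ σ).val.trace)) → ∀ (hF : Literature.NumberTheory.Automorphic.isCompact_glFiniteIntegralLevel 2 F) (ι : PadicAlgCl 2 ≃+* ℂ), ∃ π : Literature.NumberTheory.Automorphic.CuspidalAutomorphicRepData 2 F hF, π.1.IsLAlgebraic ∧ (∃ T : Literature.NumberTheory.Automorphic.InfinityType F 2, π.1.HasInfinityType T ∧ T.IsRegular) ∧ Literature.NumberTheory.Automorphic.SatakeFrobCompatibleAE ι π.1 (ρ.restrictField F) := by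
  intro ρ _ _ hunr _ F _ _ _ _ _ _ A _ _ _ _ _ _ _ _ D x₁ x₂ ρ₁ _ _ hseed htr hF ι
  obtain ⟨e, he⟩ := htr
  obtain ⟨π₁, hLalg, hT, hcompat⟩ := hseed.2 hF (e.trans ι)
  exact ⟨π₁, hLalg, hT, satakeFrobCompatibleAE_of_forall_trace_eq_ringEquiv e he
    (eventually_isUnramifiedAt_restrictField F ρ hunr) hcompat⟩

end Summit.Langlands.Langlands.Theorems.DyadicEisensteinFM

end
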